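import Summits.CriticalPhenomena.PercolationContinuityZ3.Theorems.PercNearOneGluingNoHeavyQuantGatedConvReduction
import HarnessLib

/-!
# QUANT lane R8, T-DEC: Conjecture E in CONE FORM (`GatedConvClosedT`: explicit targets, a WINDOW of layers, one gate) and its
# smallest instance, the GATED SHIFT / relay lemma (`GatedShiftDEC`: E for a sure block `δ_k`); implications
# `GatedConvClosedT ⟹ GatedConvEmptyFree ⟹ GatedShiftDEC` and the chain `ConvClosedT ∧ GatedConvClosedT ⟹ SDECConvClosed`

builds on p205010 (kernel theorem, internal audit signed; external expert review pending)

Statement + support file (`--supports stmt-CriticalPhenomena-4575`), QUANT lane typer seat prim-quant-stmt (gen 25), rung R8 of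
`run/shared/lean/prim/quant/LADDER.md`; memo `run/shared/lean/prim/quant/prim-quant-stmt-g25/GATE-INTERACTION-G25.md`.  Two `@[conjecture]`
definitions, theorems with standard axioms, no sorries.  Continues `…QuantGatedConvReduction` (typer g25: `SDECUpTo`, `@[conjecture]
GatedConvEmptyFree`, `ConvClosedT ∧ GatedConvEmptyFree ⟹ SDECConvClosed`) and lead g22's `…QuantSliceConeForm` (`@[conjecture] ConvClosedT`, the cone
form of convolution closure).

WHY.  `GatedConvEmptyFree` (E) is stated with means and all layers, the shape the reduction consumes.  The census seats' tools (exact double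
description / atomic reduction of window cones, census-2 g56; piece routing with a giant pool, census-1 CONV-G20) work on CONE statements at explicit
targets with a WINDOW of layers, the shape of `ConvClosedT`.  This file types that shape for the gated convolution and proves it implies E, so a proof
(or refutation) of the cone form settles the gate interaction; and it types the smallest open instance, the gated shift (a root vertex carrying `k`
sure relays above an SDEC forest), which every route to E must contain.
EVIDENCE (exact LP, census-2 g51's `dec_lp`; typer g25 `explore/evar.py`, kit j149372 `explore/kit_Econe`): with `μ₁(0) = 0`, explicit targets
`τ_i ∈ [5/12, 1]·q·mean_i` with `y·M_i ≤ τ_i`, both factors pushed to the boundary of their hypothesis, hypotheses ONLY on the windows: kit j149372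
3 092 pairs, 30 656 (pair, layer) instances / 0 FAIL (43 of them with the all-layers hypothesis false); local 4 688 / 0.  Gated shift: `explore/relay*.py`
1 981 random boundary-pushed + 18 918 targeted single-low instances / 0 FAIL; its natural certificate (shift every pair of `ν`'s layer-`(j−1)` flow, keep
the gate mass at `0`) needs re-routing of the gate mass away from the mids `h > T` in 52 / 735 layers (memo §4).
HONEST STATUS: `GatedConvClosedT`, `GatedShiftDEC`, `GatedConvEmptyFree`, `ConvClosedT`, `SDECConvClosed` OPEN; this file proves implications only.

* `LawDec.GatedConvClosedT` (`@[conjecture]`, cone form of E); **`gatedConvEmptyFree_of_gatedConvClosedT : GatedConvClosedT → GatedConvEmptyFree`**;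
  `sdecConvClosed_of_convClosedT_of_gatedConvClosedT`, `Quant.farTreeRow_of_convClosedT_of_gatedConvClosedT`.
* `LawDec.GatedShiftDEC` (`@[conjecture]`, the relay lemma R); `sdecUpTo_point`; **`gatedShiftDEC_of_gatedConvEmptyFree`**; `lconv_point_left`
  (`lconv k M δ_k μ = μ(· − k)`, so the conclusion of R is the gated shift `(1−q)δ₀ + q·μ(·−k)`).

[this work]; `ConvClosedT`: prim-quant-lead g22; SDEC: prim-quant-census-2 g53 (this lane).  The gluing rows served
[cite: KozmaNitzan2024, Conjecture 3 (p. 15)]; product measure [cite: Grimmett1999, §1.3 p. 10].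
-/

noncomputable section

namespace Summit.CriticalPhenomena.PercolationContinuityZ3.Theorems

namespace Quant

open Finset

namespace LawDec

/-! ### The cone form -/

/-- **CONJECTURE E IN CONE FORM (`GatedConvClosedT`; typer g25).**  For a floor `0 < y < 1`, a gate `y ≤ q ≤ 1`, probability laws `μ₁ ≥ 0` on
`{0..M₁}` WITH NO ATOM AT `0` and `μ₂ ≥ 0` on `{0..M₂}`, real targets `τ₁, τ₂` with `y·Mᵢ ≤ τᵢ`, and a layer `j < M₁ + M₂`: if the gated law
`gate μ₁ q` is DEC(j″) at target `τ₁` for every layer `j″ ≤ j` with `j ≤ j″ + M₂`, and `gate μ₂ q` is DEC(j″) at target `τ₂` for every `j″ ≤ j` with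
`j ≤ j″ + M₁` (the windows of `ConvClosedT`), then the gated convolution `gate (lconv M₁ M₂ μ₁ μ₂) q` is DEC(j) at target `τ₁ + τ₂` on `{0..M₁+M₂}`
(all at floor `y`).  For `q = 1` this is `ConvClosedT` restricted to an empty-free factor (with floor-affordable targets).  For fixed `q` the conclusion
is affine in each factor separately (`gate_q(lconv μ₁ μ₂) = lconv μ₁ (gate μ₂ q) − (1−q)(μ₁ − δ₀)`), so the statement reduces to extreme points of the two
hypothesis polytopes.  EVIDENCE: kit j149372, 30 656 window-layer instances / 0 FAIL (file header).  Implies `GatedConvEmptyFree`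
(`gatedConvEmptyFree_of_gatedConvClosedT`), hence with `ConvClosedT` the tree row (`farTreeRow_of_convClosedT_of_gatedConvClosedT`).
builds on p205010 (kernel theorem, internal audit signed; external expert review pending). [this work] [status: open] -/
@[conjecture] def GatedConvClosedT : Prop :=
  ∀ (y q τ₁ τ₂ : ℝ) (M₁ M₂ j : ℕ) (μ₁ μ₂ : ℕ → ℝ),
    0 < y → y < 1 → y ≤ q → q ≤ 1 →
    (∀ h, 0 ≤ μ₁ h) → (∀ h, M₁ < h → μ₁ h = 0) → (∑ h ∈ Finset.range (M₁ + 1), μ₁ h = 1) →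
    (∀ h, 0 ≤ μ₂ h) → (∀ h, M₂ < h → μ₂ h = 0) → (∑ h ∈ Finset.range (M₂ + 1), μ₂ h = 1) →
    μ₁ 0 = 0 → y * (M₁ : ℝ) ≤ τ₁ → y * (M₂ : ℝ) ≤ τ₂ →
    j < M₁ + M₂ →
    (∀ j'', j'' ≤ j → j ≤ j'' + M₂ → DECAtT y τ₁ j'' M₁ (gate μ₁ q)) →
    (∀ j'', j'' ≤ j → j ≤ j'' + M₁ → DECAtT y τ₂ j'' M₂ (gate μ₂ q)) →
    DECAtT y (τ₁ + τ₂) j (M₁ + M₂) (gate (lconv M₁ M₂ μ₁ μ₂) q)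

/-- **cone form ⟹ E.**  For `q ≤ Q` and a layer `j < M₁ + M₂` apply the cone form at floor `qx`, targets the gated means `q·Tᵢ`: the window layers
below the tops are SDEC-up-to-`Q` hypotheses, the layers at or above a top are Theorem A (`decAt_of_top_le`, top-affordability at floor `qx`). [this work] -/
theorem gatedConvEmptyFree_of_gatedConvClosedT (hG : GatedConvClosedT) : GatedConvEmptyFree := by
  intro x Q M₁ M₂ μ₁ μ₂ hx0 hx1 hQ0 hQ1 hQx h10 h1M h11 hta1 h20 h2M h21 hta2 hz hS1 hS2 q hq0 hqQ j hj
  set T₁ : ℝ := ∑ h ∈ Finset.range (M₁ + 1), (h : ℝ) * μ₁ h with hT₁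
  set T₂ : ℝ := ∑ h ∈ Finset.range (M₂ + 1), (h : ℝ) * μ₂ h with hT₂
  have hq1 : q ≤ 1 := hqQ.trans hQ1
  have hy0 : 0 < q * x := mul_pos hq0 hx0
  have hy1 : q * x < 1 := lt_of_le_of_lt (mul_le_mul_of_nonneg_right hqQ hx0.le) hQx
  have hyq : q * x ≤ q := mul_le_of_le_one_right hq0.le hx1
  obtain ⟨n10, n1M, n11⟩ := gate_laws M₁ μ₁ q hq0.le hq1 h10 h1M h11
  obtain ⟨n20, n2M, n21⟩ := gate_laws M₂ μ₂ q hq0.le hq1 h20 h2M h21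
  have hmean1 : ∑ k ∈ Finset.range (M₁ + 1), (k : ℝ) * gate μ₁ q k = q * T₁ := sum_mul_gate μ₁ q M₁
  have hmean2 : ∑ k ∈ Finset.range (M₂ + 1), (k : ℝ) * gate μ₂ q k = q * T₂ := sum_mul_gate μ₂ q M₂
  -- every layer of each gated factor is DEC at its mean (below the top: SDEC up to `Q`; at or above: Theorem A)
  have hall : ∀ (M : ℕ) (μ : ℕ → ℝ) (T : ℝ), (∀ h, 0 ≤ gate μ q h) → (∀ h, M < h → gate μ q h = 0) →
      (∑ h ∈ Finset.range (M + 1), gate μ q h = 1) → (∑ k ∈ Finset.range (M + 1), (k : ℝ) * gate μ q k = q * T) →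
      x * (M : ℝ) ≤ T → SDECUpTo x Q M μ → ∀ j'', DECAtT (q * x) (q * T) j'' M (gate μ q) := by
    intro M μ T g0 gM g1 gmean hta hS j''
    by_cases hlt : j'' < M
    · have := hS q hq0 hqQ j'' hlt
      rwa [decAt_iff_decAtT, gmean] at this
    · have hA := decAt_of_top_le M (gate μ q) g0 gM g1 (q * x) hy1 (fun h hh => ?_) j'' (not_lt.1 hlt)
      · rwa [decAt_iff_decAtT, gmean] at hA
      · have hhM : h ≤ M := by
          by_contra hc; exact absurd (gM h (not_le.1 hc)) (ne_of_gt hh)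
        rw [gmean]
        have : q * x * (h : ℝ) ≤ q * x * (M : ℝ) := mul_le_mul_of_nonneg_left (by exact_mod_cast hhM) hy0.le
        nlinarith
  have hconc := hG (q * x) q (q * T₁) (q * T₂) M₁ M₂ j μ₁ μ₂ hy0 hy1 hyq hq1 h10 h1M h11 h20 h2M h21 hz
    (by nlinarith) (by nlinarith) hj
    (fun j'' _ _ => hall M₁ μ₁ T₁ n10 n1M n11 hmean1 hta1 hS1 j'')
    (fun j'' _ _ => hall M₂ μ₂ T₂ n20 n2M n21 hmean2 hta2 hS2 j'')
  have hτ : ∑ k ∈ Finset.range (M₁ + M₂ + 1), (k : ℝ) * gate (lconv M₁ M₂ μ₁ μ₂) q k = q * T₁ + q * T₂ := by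
    rw [sum_mul_gate, sum_mul_lconv M₁ M₂ μ₁ μ₂ h11 h21]; ring
  rw [decAt_iff_decAtT, hτ]
  exact hconc

/-- **`ConvClosedT ∧ GatedConvClosedT ⟹ SDECConvClosed`.** [this work] -/
theorem sdecConvClosed_of_convClosedT_of_gatedConvClosedT (hC : ConvClosedT) (hG : GatedConvClosedT) : SDECConvClosed :=
  sdecConvClosed_of_convClosedT_of_gatedConvEmptyFree hC (gatedConvEmptyFree_of_gatedConvClosedT hG)

/-! ### The smallest instance: the gated shift (relay lemma) -/

/-- **`lconv` with a sure block on the left is the shift**: `lconv k M δ_k μ = μ(· − k)` for `μ` vanishing above `M`. [this work] -/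
theorem lconv_point_left (k M : ℕ) (μ : ℕ → ℝ) (hμM : ∀ h, M < h → μ h = 0) (h : ℕ) :
    lconv k M (fun i => if i = k then (1 : ℝ) else 0) μ h = if k ≤ h then μ (h - k) else 0 := by
  simp only [lconv]
  rw [Finset.sum_eq_single k]
  · simp only [if_true, one_mul]
    by_cases hk : k ≤ h
    · rw [if_pos hk]
      have e : ∀ t : ℕ, (if k + t = h then μ t else 0) = μ (h - k) * (if h - k = t then (1 : ℝ) else 0) := by
        intro t
        by_cases ht : h - k = t
        · rw [if_pos ht, if_pos (by omega), ht, mul_one]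
        · rw [if_neg ht, if_neg (by omega), mul_zero]
      simp_rw [e]
      rw [← Finset.mul_sum]
      have := sum_indicator (fun _ => (1 : ℝ)) (M + 1) (h - k)
      simp only [one_mul] at this
      rw [this]
      split_ifs with hh
      · rw [mul_one]
      · rw [mul_zero]; exact (hμM (h - k) (by omega)).symm
    · rw [if_neg hk]
      exact Finset.sum_eq_zero fun t _ => if_neg (by omega)
  · intro i _ hik
    exact Finset.sum_eq_zero fun t _ => by rw [if_neg hik]; split_ifs <;> simp
  · intro hk; exact absurd (Finset.mem_range.2 (Nat.lt_succ_self k)) hk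

/-- sure blocks are SDEC up to every level `Q ≤ 1` at every floor `0 < x ≤ 1` (`sdec_point`). [this work] -/
theorem sdecUpTo_point (x Q : ℝ) (hx0 : 0 < x) (hx1 : x ≤ 1) (hQ1 : Q ≤ 1) (k : ℕ) :
    SDECUpTo x Q k (fun i => if i = k then (1 : ℝ) else 0) :=
  fun q hq0 hqQ j' hj => sdec_point x hx0 hx1 k q hq0 (hqQ.trans hQ1) j' hj

/-- **CONJECTURE R (GATED SHIFT / RELAY LEMMA; typer g25) — `GatedConvEmptyFree` for a sure block `μ₁ = δ_k`.**  For a base floor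
`0 < x ≤ 1`, a level `0 < Q ≤ 1` with `Q·x < 1`, `k ≥ 1`, and a probability law `μ` on `{0..M}` (top-affordable, `x·M ≤ mean`) that is SDEC up to `Q`
at `x`: the law `lconv k M δ_k μ` — i.e. `μ` shifted up by `k` (`lconv_point_left`), whose gate by `q` is `(1−q)δ₀ + q·μ(·−k)`, a root vertex
carrying `k` sure relays above a forest with law `μ` — is SDEC up to `Q` at `x`.  The gate mass stays at `0` while everything else moves up by `k`
and the target by `q·k` (not the `2k` of `decAt_shift`).  EVIDENCE: file header (≈ 21 000 exact instances / 0).  STRUCTURE (memo §4): after the shift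
every pair of a layer-`(j−1)` flow of `gate μ q` keeps or lowers its usage except the gate-zero pairs into mids `h > mean μ`, whose re-routing is the
whole content. [this work] [status: open] -/
@[conjecture] def GatedShiftDEC : Prop :=
  ∀ (x Q : ℝ) (k M : ℕ) (μ : ℕ → ℝ),
    0 < x → x ≤ 1 → 0 < Q → Q ≤ 1 → Q * x < 1 → 1 ≤ k →
    (∀ h, 0 ≤ μ h) → (∀ h, M < h → μ h = 0) → (∑ h ∈ Finset.range (M + 1), μ h = 1) →
    x * (M : ℝ) ≤ ∑ h ∈ Finset.range (M + 1), (h : ℝ) * μ h →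
    SDECUpTo x Q M μ →
    SDECUpTo x Q (k + M) (lconv k M (fun i => if i = k then (1 : ℝ) else 0) μ)

/-- **E ⟹ R**: a sure block `δ_k` (`k ≥ 1`) is an empty-free, top-affordable probability law, SDEC up to every level. [this work] -/
theorem gatedShiftDEC_of_gatedConvEmptyFree (hE : GatedConvEmptyFree) : GatedShiftDEC := by
  intro x Q k M μ hx0 hx1 hQ0 hQ1 hQx hk hμ0 hμM hμ1 hta hS
  have p0 : ∀ h, 0 ≤ (fun i => if i = k then (1 : ℝ) else 0) h := fun h => by
    simp only; split_ifs <;> norm_num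
  have pM : ∀ h, k < h → (fun i => if i = k then (1 : ℝ) else 0) h = 0 := fun h hh => by
    simp only; rw [if_neg (by omega)]
  have p1 : ∑ h ∈ Finset.range (k + 1), (fun i => if i = k then (1 : ℝ) else 0) h = 1 := by
    simp only
    rw [Finset.sum_ite_eq' (Finset.range (k + 1)) k, if_pos (Finset.mem_range.2 (Nat.lt_succ_self k))]
  have pmean : ∑ h ∈ Finset.range (k + 1), (h : ℝ) * (fun i => if i = k then (1 : ℝ) else 0) h = k := by
    have := sum_indicator (fun h : ℕ => (h : ℝ)) (k + 1) k
    rw [if_pos (Nat.lt_succ_self k)] at this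
    rw [← this]
    refine Finset.sum_congr rfl fun h _ => ?_
    simp only [eq_comm]
  have pta : x * (k : ℝ) ≤ ∑ h ∈ Finset.range (k + 1), (h : ℝ) * (fun i => if i = k then (1 : ℝ) else 0) h := by
    rw [pmean]; nlinarith [(Nat.cast_nonneg k : (0 : ℝ) ≤ k)]
  have pz : (fun i => if i = k then (1 : ℝ) else 0) 0 = 0 := by simp only; rw [if_neg (by omega)]
  exact hE x Q k M _ μ hx0 hx1 hQ0 hQ1 hQx p0 pM p1 pta hμ0 hμM hμ1 hta pz (sdecUpTo_point x Q hx0 hx1 hQ1 k) hS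

end LawDec

/-- **`ConvClosedT ∧ GatedConvClosedT ⟹ Quant.FarTreeRow`** (cone forms only on the left). CONDITIONAL result. [this work] -/
theorem farTreeRow_of_convClosedT_of_gatedConvClosedT (hC : LawDec.ConvClosedT) (hG : LawDec.GatedConvClosedT) : FarTreeRow :=
  farTreeRow_of_convClosedT_of_gatedConvEmptyFree hC (LawDec.gatedConvEmptyFree_of_gatedConvClosedT hG)

end Quant

end Summit.CriticalPhenomena.PercolationContinuityZ3.Theorems
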